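import Summits.CriticalPhenomena.PercolationContinuityZ3.Theorems.PercNearOneGluingNoHeavyLowerTailKnQuestion8CoefficientwiseCoreClassKernelMixLeaf
import Summits.CriticalPhenomena.PercolationContinuityZ3.Theorems.PercNearOneGluingNoHeavyLowerTailKnQuestion8CoefficientwiseCoreClassKernelWrapper
import Summits.CriticalPhenomena.PercolationContinuityZ3.Theorems.PercNearOneGluingNoHeavyLowerTailKnQuestion8CoefficientwiseCoreClassDomBundle
import HarnessLib

/-!
# THEOREM TWO LEAVES: CW-PA on the core class over `a′a + H + bb′` for every middle graph `H` with a proper domination map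

Support file (`--supports stmt-CriticalPhenomena-4575`, closed), prover `prim-cplus-coupling` (gen 31).  No definitions, no notations, no named facts,
no sorries; standard axioms.  Memo `prim-cplus-coupling/A5-COUPLING-gen31.md` §1.  Built on `…CoreClassKernelMix` (KB-MIX: from a proper map, terminal
symmetry, to the kernel), `…CoreClassKernelMixLeaf` (KB-MIX is stable under a terminal leaf), `…CoreClassKernelWrapper` (kernel ⟹ CW-PA).

Setting: middle graph `E` with terminals `a, b` and a PROPER DOMINATION MAP `ψ` (injective on the wall event `{b ∉ C_a ω, b ∉ C_a(E∖ω)}`, `ψ ω ⊆ E`,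
`C_a ω ∪ C_b(E∖ω) ⊆ C_a(ψω) ∪ C_b(ψω)`, `b ∉ C_a(ψω)`; e.g. the involution `R_A` of a pocket-free `(E; a, b)` — all thread bundles `Θ(k₁,…,k_r)`, every
`H` with `a ~ V ∖ b` — and parallel products); two NEW pendant edges `e₁ = a′a`, `e₂ = b′b` (`a′, b′` fresh).  The enlarged middle graph
`E₂ = insert e₂ (insert e₁ E)` with terminals `a′, b′` has NO domination map in general: the seven 'taut' two-terminal graphs on 8 vertices without one
(exact census, memo gen 30 §2.3) are all of this leaf–bundle–leaf shape.  Nevertheless: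
* `Coefficientwise.coreClass_kernel_nonneg_leaf_leaf` — the core-class kernel of `(E₂; a′, b′)` is `≥ 0` for all monotone `f` (`f ∅ = 0`), `g`.
  Proof: proper map ⟹ KB-MIX`(E; a, b)` ⟹ (leaf) KB-MIX`(e₁ + E; a′, b)` ⟹ (symmetry) KB-MIX`(e₁ + E; b, a′)` ⟹ (leaf) KB-MIX`(E₂; b′, a′)` ⟹ (symmetry,
  equal levels) kernel.
* `Coefficientwise.cwpa_coreClass_of_leaf_leaf` — hence **CW-PA on the core class `N(x) = N(z) = {a′, b′}` over `E₂` for ALL monotone `f, g`**: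
  `0 ≤ Σ_{s ⊆ E₀ : z ∉ C_x(s), z ∉ C_x(E₀∖s)} f(C_x s)(g(C_x s) − g(C_x(E₀∖s)))`.
* `Coefficientwise.cwpa_coreClass_of_leaf_pocketFree_leaf`, `Coefficientwise.cwpa_coreClass_of_leaf_degLeTwo_leaf` — the instances 'pocket-free middle'
  and 'middle of internal degree ≤ 2' (leaf–`Θ(k₁,…,k_r)`–leaf: the seven 8-vertex graphs and all their relatives).
[cite: KozmaNitzan2024, Questions 8–9 (§5.5 p. 36) (context: the Question-8 pocket covariance programme)]
-/

namespace Summit.CriticalPhenomena.PercolationContinuityZ3.Theorems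

open Finset Literature.Probability.Percolation
open scoped symmDiff

namespace Coefficientwise

variable {ι V : Type*}

open Classical in
/-- **Two terminal leaves: the kernel.**  Middle graph `E`, terminals `a, b`, a proper domination map `ψ` of `(E; a, b)`; new edges `e₁ ∉ E`,
`e₂ ∉ insert e₁ E` with `ends e₁ = s(a′, a)`, `ends e₂ = s(b′, b)`, `a′` on no edge of `E`, `b′` on no edge of `insert e₁ E`, `a′ ≠ a, b`, `b′ ≠ b, a′`.
Then for every monotone `f` with `f ∅ = 0` and monotone `g`, with `E₂ = insert e₂ (insert e₁ E)`:
`0 ≤ Σ_{ω ⊆ E₂} f(C_{a′} ∪ C_{b′})(g(C_{a′} ∪ C_{b′}) − g ∅) + Σ_{ω : b′ ∉ C_{a′} ω, b′ ∉ C_{a′}(E₂∖ω)} [f(C_{a′} ω)(g(C_{a′} ω) − g(C_{b′}(E₂∖ω))) + f(C_{b′} ω)(g(C_{b′} ω) − g(C_{a′}(E₂∖ω)))]`.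
[cite: KozmaNitzan2024, Questions 8–9 (§5.5 p. 36) (context)] -/
theorem coreClass_kernel_nonneg_leaf_leaf (ends : ι → Sym2 V) (E : Finset ι) (e₁ e₂ : ι) (a a' b b' : V)
    (he₁ : e₁ ∉ E) (he₂ : e₂ ∉ insert e₁ E) (hends₁ : ends e₁ = s(a', a)) (hends₂ : ends e₂ = s(b', b))
    (ha'E : ∀ i ∈ E, a' ∉ ends i) (hb'E : ∀ i ∈ insert e₁ E, b' ∉ ends i)
    (ha'a : a' ≠ a) (ha'b : a' ≠ b) (hb'b : b' ≠ b) (hb'a' : b' ≠ a')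
    (ψ : Finset ι → Finset ι)
    (hψE : ∀ ω, ω ⊆ E → b ∉ openCluster (ends '' (↑ω : Set ι)) a → b ∉ openCluster (ends '' (↑(E \ ω) : Set ι)) a → ψ ω ⊆ E)
    (hψcov : ∀ ω, ω ⊆ E → b ∉ openCluster (ends '' (↑ω : Set ι)) a → b ∉ openCluster (ends '' (↑(E \ ω) : Set ι)) a →
      openCluster (ends '' (↑ω : Set ι)) a ∪ openCluster (ends '' (↑(E \ ω) : Set ι)) b ⊆
        openCluster (ends '' (↑(ψ ω) : Set ι)) a ∪ openCluster (ends '' (↑(ψ ω) : Set ι)) b)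
    (hψinj : ∀ ω₁ ω₂, ω₁ ⊆ E → b ∉ openCluster (ends '' (↑ω₁ : Set ι)) a → b ∉ openCluster (ends '' (↑(E \ ω₁) : Set ι)) a →
      ω₂ ⊆ E → b ∉ openCluster (ends '' (↑ω₂ : Set ι)) a → b ∉ openCluster (ends '' (↑(E \ ω₂) : Set ι)) a → ψ ω₁ = ψ ω₂ → ω₁ = ω₂)
    (hψprop : ∀ ω, ω ⊆ E → b ∉ openCluster (ends '' (↑ω : Set ι)) a → b ∉ openCluster (ends '' (↑(E \ ω) : Set ι)) a →
      b ∉ openCluster (ends '' (↑(ψ ω) : Set ι)) a)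
    (f g : Set V → ℝ) (hf : Monotone f) (hf0 : f ∅ = 0) (hg : Monotone g) :
    0 ≤ (∑ ω ∈ (insert e₂ (insert e₁ E)).powerset,
        f (openCluster (ends '' (↑ω : Set ι)) a' ∪ openCluster (ends '' (↑ω : Set ι)) b') *
          (g (openCluster (ends '' (↑ω : Set ι)) a' ∪ openCluster (ends '' (↑ω : Set ι)) b') - g ∅))
      + ∑ ω ∈ (insert e₂ (insert e₁ E)).powerset.filter (fun ω : Finset ι => b' ∉ openCluster (ends '' (↑ω : Set ι)) a' ∧
            b' ∉ openCluster (ends '' (↑((insert e₂ (insert e₁ E)) \ ω) : Set ι)) a'),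
        (f (openCluster (ends '' (↑ω : Set ι)) a') *
            (g (openCluster (ends '' (↑ω : Set ι)) a') - g (openCluster (ends '' (↑((insert e₂ (insert e₁ E)) \ ω) : Set ι)) b'))
          + f (openCluster (ends '' (↑ω : Set ι)) b') *
            (g (openCluster (ends '' (↑ω : Set ι)) b') - g (openCluster (ends '' (↑((insert e₂ (insert e₁ E)) \ ω) : Set ι)) a'))) := by
  set C : Finset ι → V → Set V := fun ω v => openCluster (ends '' (↑ω : Set ι)) v with hC
  set E₁ : Finset ι := insert e₁ E with hE₁
  set E₂ : Finset ι := insert e₂ E₁ with hE₂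
  -- stage 1: KB-MIX for (E₁; a', b) at all levels
  have s1 : ∀ h k ha hb ka kb : Set V → ℝ, Monotone h → Monotone k → Monotone ha → Monotone hb → Monotone ka → Monotone kb →
      (∀ X, 0 ≤ ha X) → (∀ X, ha X ≤ h X) → (∀ X, 0 ≤ hb X) → (∀ X, hb X ≤ h X) →
      (∀ X, 0 ≤ ka X) → (∀ X, ka X ≤ k X) → (∀ X, 0 ≤ kb X) → (∀ X, kb X ≤ k X) →
      0 ≤ (∑ ω ∈ E₁.powerset.filter (fun ω : Finset ι => b ∉ C ω a'), h (C ω a' ∪ C ω b) * k (C ω a' ∪ C ω b))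
        + ∑ ω ∈ E₁.powerset.filter (fun ω : Finset ι => b ∉ C ω a' ∧ b ∉ C (E₁ \ ω) a'),
          (ha (C ω a') - hb (C (E₁ \ ω) b)) * (ka (C ω a') - kb (C (E₁ \ ω) b)) := by
    intro h k ha hb ka kb hh hk mha mhb mka mkb ha0 hah hb0 hbh ka0 kak kb0 kbk
    refine coreClass_kernelMix_leaf ends E e₁ a a' b he₁ hends₁ ha'E ha'a ha'b h k ha hb ka kb hh hk mha mhb mka mkb
      ha0 hah hb0 hbh ka0 kak kb0 kbk ?_
    exact coreClass_kernelMix_of_properDom ends E a b (fun X => h (insert a' X)) (fun X => k (insert a' X))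
      (fun X => ha (insert a' X)) hb (fun X => ka (insert a' X)) kb
      (fun X Y hXY => hh (Set.insert_subset_insert hXY)) (fun X Y hXY => hk (Set.insert_subset_insert hXY))
      (fun X => ha0 _) (fun X => hah _) (fun X => hb0 _) (fun X => le_trans (hbh X) (hh (Set.subset_insert _ _)))
      (fun X => ka0 _) (fun X => kak _) (fun X => kb0 _) (fun X => le_trans (kbk X) (hk (Set.subset_insert _ _)))
      ψ hψE hψcov hψinj hψprop
  -- stage 2: KB-MIX for (E₁; b, a') at all levels (terminal symmetry)
  have s2 : ∀ h k ha hb ka kb : Set V → ℝ, Monotone h → Monotone k → Monotone ha → Monotone hb → Monotone ka → Monotone kb →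
      (∀ X, 0 ≤ ha X) → (∀ X, ha X ≤ h X) → (∀ X, 0 ≤ hb X) → (∀ X, hb X ≤ h X) →
      (∀ X, 0 ≤ ka X) → (∀ X, ka X ≤ k X) → (∀ X, 0 ≤ kb X) → (∀ X, kb X ≤ k X) →
      0 ≤ (∑ ω ∈ E₁.powerset.filter (fun ω : Finset ι => a' ∉ C ω b), h (C ω b ∪ C ω a') * k (C ω b ∪ C ω a'))
        + ∑ ω ∈ E₁.powerset.filter (fun ω : Finset ι => a' ∉ C ω b ∧ a' ∉ C (E₁ \ ω) b),
          (ha (C ω b) - hb (C (E₁ \ ω) a')) * (ka (C ω b) - kb (C (E₁ \ ω) a')) := by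
    intro h k ha hb ka kb hh hk mha mhb mka mkb ha0 hah hb0 hbh ka0 kak kb0 kbk
    rw [coreClass_kernelMix_comm ends E₁ a' b h k hb ha kb ka]
    exact s1 h k hb ha kb ka hh hk mhb mha mkb mka hb0 hbh ha0 hah kb0 kbk ka0 kak
  -- stage 3: KB-MIX for (E₂; b', a') at all levels (leaf at b)
  have s3 : ∀ h k ha hb ka kb : Set V → ℝ, Monotone h → Monotone k → Monotone ha → Monotone hb → Monotone ka → Monotone kb →
      (∀ X, 0 ≤ ha X) → (∀ X, ha X ≤ h X) → (∀ X, 0 ≤ hb X) → (∀ X, hb X ≤ h X) →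
      (∀ X, 0 ≤ ka X) → (∀ X, ka X ≤ k X) → (∀ X, 0 ≤ kb X) → (∀ X, kb X ≤ k X) →
      0 ≤ (∑ ω ∈ E₂.powerset.filter (fun ω : Finset ι => a' ∉ C ω b'), h (C ω b' ∪ C ω a') * k (C ω b' ∪ C ω a'))
        + ∑ ω ∈ E₂.powerset.filter (fun ω : Finset ι => a' ∉ C ω b' ∧ a' ∉ C (E₂ \ ω) b'),
          (ha (C ω b') - hb (C (E₂ \ ω) a')) * (ka (C ω b') - kb (C (E₂ \ ω) a')) := by
    intro h k ha hb ka kb hh hk mha mhb mka mkb ha0 hah hb0 hbh ka0 kak kb0 kbk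
    refine coreClass_kernelMix_leaf ends E₁ e₂ b b' a' he₂ hends₂ hb'E hb'b hb'a' h k ha hb ka kb hh hk mha mhb mka mkb
      ha0 hah hb0 hbh ka0 kak kb0 kbk ?_
    exact s2 (fun X => h (insert b' X)) (fun X => k (insert b' X)) (fun X => ha (insert b' X)) hb (fun X => ka (insert b' X)) kb
      (fun X Y hXY => hh (Set.insert_subset_insert hXY)) (fun X Y hXY => hk (Set.insert_subset_insert hXY))
      (fun X Y hXY => mha (Set.insert_subset_insert hXY)) mhb (fun X Y hXY => mka (Set.insert_subset_insert hXY)) mkb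
      (fun X => ha0 _) (fun X => hah _) (fun X => hb0 _) (fun X => le_trans (hbh X) (hh (Set.subset_insert _ _)))
      (fun X => ka0 _) (fun X => kak _) (fun X => kb0 _) (fun X => le_trans (kbk X) (hk (Set.subset_insert _ _)))
  -- stage 4: back to (E₂; a', b') at equal levels, then the kernel
  have hf_nonneg : ∀ X : Set V, 0 ≤ f X := fun X => by rw [← hf0]; exact hf (Set.empty_subset X)
  have hg' : Monotone (fun X : Set V => g X - g ∅) := fun X Y hXY => sub_le_sub_right (hg hXY) _
  have hg0 : ∀ X : Set V, 0 ≤ g X - g ∅ := fun X => sub_nonneg.mpr (hg (Set.empty_subset X))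
  have s4 : 0 ≤ (∑ ω ∈ E₂.powerset.filter (fun ω : Finset ι => b' ∉ C ω a'),
        f (C ω a' ∪ C ω b') * (g (C ω a' ∪ C ω b') - g ∅))
      + ∑ ω ∈ E₂.powerset.filter (fun ω : Finset ι => b' ∉ C ω a' ∧ b' ∉ C (E₂ \ ω) a'),
        (f (C ω a') - f (C (E₂ \ ω) b')) * ((g (C ω a') - g ∅) - (g (C (E₂ \ ω) b') - g ∅)) := by
    rw [← coreClass_kernelMix_comm ends E₂ a' b' f (fun X : Set V => g X - g ∅) f f (fun X : Set V => g X - g ∅) (fun X : Set V => g X - g ∅)]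
    exact s3 f (fun X : Set V => g X - g ∅) f f (fun X : Set V => g X - g ∅) (fun X : Set V => g X - g ∅) hf hg' hf hf hg' hg'
      hf_nonneg (fun X => le_refl _) hf_nonneg (fun X => le_refl _) hg0 (fun X => le_refl _) hg0 (fun X => le_refl _)
  exact coreClass_kernel_nonneg_of_kernelMix ends E₂ a' b' f g hf hf0 hg s4

open Classical in
/-- **THEOREM TWO LEAVES — CW-PA on the core class `N(x) = N(z) = {a′, b′}` over `a′a + H + bb′`, `H` with a proper domination map.**
Core-class bookkeeping for the middle graph `E₂ = insert e₂ (insert e₁ E_H)` (terminals `a′, b′`, joined to `x` and `z` by `ixa, ixb, iza, izb`, no edge of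
`E₂` at `x, z`); `e₁ = a′a ∉ E_H`, `e₂ = b′b ∉ insert e₁ E_H`, `a′` on no edge of `E_H`, `b′` on no edge of `insert e₁ E_H`, `a′ ≠ a, b`, `b′ ≠ b, a′`; a proper
domination map `ψ` of `(E_H; a, b)`.  Then for all monotone `f, g`: `0 ≤ Σ_{s ⊆ E₀ : z ∉ C_x(s), z ∉ C_x(E₀∖s)} f(C_x s)·(g(C_x s) − g(C_x(E₀∖s)))`.
[cite: KozmaNitzan2024, Questions 8–9 (§5.5 p. 36) (context)] -/
theorem cwpa_coreClass_of_leaf_leaf (ends : ι → Sym2 V) (EH E₀ : Finset ι) (x z a a' b b' : V) (e₁ e₂ ixa ixb iza izb : ι)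
    (he₁ : e₁ ∉ EH) (he₂ : e₂ ∉ insert e₁ EH) (hends₁ : ends e₁ = s(a', a)) (hends₂ : ends e₂ = s(b', b))
    (ha'E : ∀ i ∈ EH, a' ∉ ends i) (hb'E : ∀ i ∈ insert e₁ EH, b' ∉ ends i)
    (ha'a : a' ≠ a) (ha'b : a' ≠ b) (hb'b : b' ≠ b) (hb'a' : b' ≠ a')
    (hxa : ends ixa = s(x, a')) (hxb : ends ixb = s(x, b')) (hza : ends iza = s(z, a')) (hzb : ends izb = s(z, b'))
    (hH : ∀ i ∈ insert e₂ (insert e₁ EH), x ∉ ends i ∧ z ∉ ends i)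
    (hE₀ : ∀ i, i ∈ E₀ ↔ i ∈ insert e₂ (insert e₁ EH) ∨ i = ixa ∨ i = ixb ∨ i = iza ∨ i = izb)
    (hnot : ixa ∉ insert e₂ (insert e₁ EH) ∧ ixb ∉ insert e₂ (insert e₁ EH) ∧ iza ∉ insert e₂ (insert e₁ EH) ∧ izb ∉ insert e₂ (insert e₁ EH))
    (hd : ixa ≠ ixb ∧ ixa ≠ iza ∧ ixa ≠ izb ∧ ixb ≠ iza ∧ ixb ≠ izb ∧ iza ≠ izb)
    (hxz : x ≠ z) (hxa' : x ≠ a') (hxb' : x ≠ b') (hza' : z ≠ a') (hzb' : z ≠ b')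
    (ψ : Finset ι → Finset ι)
    (hψE : ∀ ω, ω ⊆ EH → b ∉ openCluster (ends '' (↑ω : Set ι)) a → b ∉ openCluster (ends '' (↑(EH \ ω) : Set ι)) a → ψ ω ⊆ EH)
    (hψcov : ∀ ω, ω ⊆ EH → b ∉ openCluster (ends '' (↑ω : Set ι)) a → b ∉ openCluster (ends '' (↑(EH \ ω) : Set ι)) a →
      openCluster (ends '' (↑ω : Set ι)) a ∪ openCluster (ends '' (↑(EH \ ω) : Set ι)) b ⊆
        openCluster (ends '' (↑(ψ ω) : Set ι)) a ∪ openCluster (ends '' (↑(ψ ω) : Set ι)) b)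
    (hψinj : ∀ ω₁ ω₂, ω₁ ⊆ EH → b ∉ openCluster (ends '' (↑ω₁ : Set ι)) a → b ∉ openCluster (ends '' (↑(EH \ ω₁) : Set ι)) a →
      ω₂ ⊆ EH → b ∉ openCluster (ends '' (↑ω₂ : Set ι)) a → b ∉ openCluster (ends '' (↑(EH \ ω₂) : Set ι)) a → ψ ω₁ = ψ ω₂ → ω₁ = ω₂)
    (hψprop : ∀ ω, ω ⊆ EH → b ∉ openCluster (ends '' (↑ω : Set ι)) a → b ∉ openCluster (ends '' (↑(EH \ ω) : Set ι)) a →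
      b ∉ openCluster (ends '' (↑(ψ ω) : Set ι)) a)
    (f g : Set V → ℝ) (hf : Monotone f) (hg : Monotone g) :
    0 ≤ ∑ s ∈ E₀.powerset.filter (fun s : Finset ι => z ∉ openCluster (ends '' (↑s : Set ι)) x ∧ z ∉ openCluster (ends '' (↑(E₀ \ s) : Set ι)) x),
      f (openCluster (ends '' (↑s : Set ι)) x) * (g (openCluster (ends '' (↑s : Set ι)) x) - g (openCluster (ends '' (↑(E₀ \ s) : Set ι)) x)) :=
  cwpa_coreClass_of_kernel ends (insert e₂ (insert e₁ EH)) E₀ x z a' b' ixa ixb iza izb hxa hxb hza hzb hH hE₀ hnot hd hxz hxa' hxb' hza' hzb'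
    (fun f' g' hf' hf0' hg' => coreClass_kernel_nonneg_leaf_leaf ends EH e₁ e₂ a a' b b' he₁ he₂ hends₁ hends₂ ha'E hb'E ha'a ha'b hb'b hb'a'
      ψ hψE hψcov hψinj hψprop f' g' hf' hf0' hg') f g hf hg

open Classical in
/-- **Two leaves on a pocket-free middle graph.**  As `cwpa_coreClass_of_leaf_leaf`, with the proper domination map replaced by the POCKET-FREE hypothesis
on `(E_H; a, b)`: for every `ω ⊆ E_H` in the wall event, `C_b(E_H ∖ ω) ⊆ C_a(ω) ∪ C_b({i ∈ E_H ∖ ω : i meets no vertex of C_a(ω)})` (the map is the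
involution `R_A(ω) = ω ∆ {edges away from C_a(ω)}` of `…CoreClassDomPocketFree`).  Conclusion: CW-PA on the core class over `a′a + H + bb′` for all monotone
`f, g`. [cite: KozmaNitzan2024, Questions 8–9 (§5.5 p. 36) (context)] -/
theorem cwpa_coreClass_of_leaf_pocketFree_leaf (ends : ι → Sym2 V) (EH E₀ : Finset ι) (x z a a' b b' : V) (e₁ e₂ ixa ixb iza izb : ι)
    (he₁ : e₁ ∉ EH) (he₂ : e₂ ∉ insert e₁ EH) (hends₁ : ends e₁ = s(a', a)) (hends₂ : ends e₂ = s(b', b))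
    (ha'E : ∀ i ∈ EH, a' ∉ ends i) (hb'E : ∀ i ∈ insert e₁ EH, b' ∉ ends i)
    (ha'a : a' ≠ a) (ha'b : a' ≠ b) (hb'b : b' ≠ b) (hb'a' : b' ≠ a')
    (hxa : ends ixa = s(x, a')) (hxb : ends ixb = s(x, b')) (hza : ends iza = s(z, a')) (hzb : ends izb = s(z, b'))
    (hH : ∀ i ∈ insert e₂ (insert e₁ EH), x ∉ ends i ∧ z ∉ ends i)
    (hE₀ : ∀ i, i ∈ E₀ ↔ i ∈ insert e₂ (insert e₁ EH) ∨ i = ixa ∨ i = ixb ∨ i = iza ∨ i = izb)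
    (hnot : ixa ∉ insert e₂ (insert e₁ EH) ∧ ixb ∉ insert e₂ (insert e₁ EH) ∧ iza ∉ insert e₂ (insert e₁ EH) ∧ izb ∉ insert e₂ (insert e₁ EH))
    (hd : ixa ≠ ixb ∧ ixa ≠ iza ∧ ixa ≠ izb ∧ ixb ≠ iza ∧ ixb ≠ izb ∧ iza ≠ izb)
    (hxz : x ≠ z) (hxa' : x ≠ a') (hxb' : x ≠ b') (hza' : z ≠ a') (hzb' : z ≠ b')
    (hpf : ∀ ω, ω ⊆ EH → b ∉ openCluster (ends '' (↑ω : Set ι)) a → b ∉ openCluster (ends '' (↑(EH \ ω) : Set ι)) a →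
      openCluster (ends '' (↑(EH \ ω) : Set ι)) b ⊆ openCluster (ends '' (↑ω : Set ι)) a ∪
        openCluster (ends '' (↑((EH \ ω).filter (fun i => ∀ v, v ∈ ends i → v ∉ openCluster (ends '' (↑ω : Set ι)) a)) : Set ι)) b)
    (f g : Set V → ℝ) (hf : Monotone f) (hg : Monotone g) :
    0 ≤ ∑ s ∈ E₀.powerset.filter (fun s : Finset ι => z ∉ openCluster (ends '' (↑s : Set ι)) x ∧ z ∉ openCluster (ends '' (↑(E₀ \ s) : Set ι)) x),
      f (openCluster (ends '' (↑s : Set ι)) x) * (g (openCluster (ends '' (↑s : Set ι)) x) - g (openCluster (ends '' (↑(E₀ \ s) : Set ι)) x)) := by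
  refine cwpa_coreClass_of_leaf_leaf ends EH E₀ x z a a' b b' e₁ e₂ ixa ixb iza izb he₁ he₂ hends₁ hends₂ ha'E hb'E ha'a ha'b hb'b hb'a'
    hxa hxb hza hzb hH hE₀ hnot hd hxz hxa' hxb' hza' hzb'
    (fun ω => ω ∆ EH.filter (fun i => ∀ v, v ∈ ends i → v ∉ openCluster (ends '' (↑ω : Set ι)) a)) ?_ ?_ ?_ ?_ f g hf hg
  · -- stays inside `E_H`
    intro ω hω _ _ i hi
    rw [Finset.mem_symmDiff, Finset.mem_filter] at hi
    rcases hi with ⟨hi', _⟩ | ⟨hi', _⟩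
    · exact hω hi'
    · exact hi'.1
  · -- coverage
    intro ω hω hbR hbB
    rw [openCluster_toggleOff_eq ends EH ω a]
    intro y hy
    rcases hy with hy | hy
    · exact Or.inl hy
    · rcases hpf ω hω hbR hbB hy with hy' | hy'
      · exact Or.inl hy'
      · exact Or.inr (openCluster_sdiff_off_subset_toggleOff ends EH ω a b hy')
  · -- injectivity (involution)
    intro ω₁ ω₂ _ _ _ _ _ _ heq
    have h1 := toggleOff_toggleOff ends EH ω₁ a
    have h2 := toggleOff_toggleOff ends EH ω₂ a
    beta_reduce at h1 h2
    rw [← h1, ← h2, heq]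
  · -- properness: `C_a(R_A ω) = C_a(ω) ∌ b`
    intro ω _ hbR _
    rw [openCluster_toggleOff_eq ends EH ω a]
    exact hbR

open Classical in
/-- **Two leaves on a middle graph of internal degree `≤ 2` (leaf–`Θ(k₁,…,k_r)`–leaf).**  As `cwpa_coreClass_of_leaf_leaf`, with the hypothesis that no vertex
`u ≠ a, b` lies on three distinct edges of `E_H` (all bundles of `a–b` threads, with or without the edge `ab`).  These middle graphs `a′a + Θ + bb′` include the
seven taut two-terminal graphs on 8 vertices WITHOUT a domination map (memo gen 30 §2.3); CW-PA holds on the core class over them for all monotone `f, g`.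
[cite: KozmaNitzan2024, Questions 8–9 (§5.5 p. 36) (context)] -/
theorem cwpa_coreClass_of_leaf_degLeTwo_leaf (ends : ι → Sym2 V) (EH E₀ : Finset ι) (x z a a' b b' : V) (e₁ e₂ ixa ixb iza izb : ι)
    (he₁ : e₁ ∉ EH) (he₂ : e₂ ∉ insert e₁ EH) (hends₁ : ends e₁ = s(a', a)) (hends₂ : ends e₂ = s(b', b))
    (ha'E : ∀ i ∈ EH, a' ∉ ends i) (hb'E : ∀ i ∈ insert e₁ EH, b' ∉ ends i)
    (ha'a : a' ≠ a) (ha'b : a' ≠ b) (hb'b : b' ≠ b) (hb'a' : b' ≠ a')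
    (hxa : ends ixa = s(x, a')) (hxb : ends ixb = s(x, b')) (hza : ends iza = s(z, a')) (hzb : ends izb = s(z, b'))
    (hH : ∀ i ∈ insert e₂ (insert e₁ EH), x ∉ ends i ∧ z ∉ ends i)
    (hE₀ : ∀ i, i ∈ E₀ ↔ i ∈ insert e₂ (insert e₁ EH) ∨ i = ixa ∨ i = ixb ∨ i = iza ∨ i = izb)
    (hnot : ixa ∉ insert e₂ (insert e₁ EH) ∧ ixb ∉ insert e₂ (insert e₁ EH) ∧ iza ∉ insert e₂ (insert e₁ EH) ∧ izb ∉ insert e₂ (insert e₁ EH))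
    (hd : ixa ≠ ixb ∧ ixa ≠ iza ∧ ixa ≠ izb ∧ ixb ≠ iza ∧ ixb ≠ izb ∧ iza ≠ izb)
    (hxz : x ≠ z) (hxa' : x ≠ a') (hxb' : x ≠ b') (hza' : z ≠ a') (hzb' : z ≠ b')
    (hdeg : ∀ u, u ≠ a → u ≠ b → ∀ i j k, i ∈ EH → j ∈ EH → k ∈ EH → u ∈ ends i → u ∈ ends j → u ∈ ends k → i = j ∨ i = k ∨ j = k)
    (f g : Set V → ℝ) (hf : Monotone f) (hg : Monotone g) :
    0 ≤ ∑ s ∈ E₀.powerset.filter (fun s : Finset ι => z ∉ openCluster (ends '' (↑s : Set ι)) x ∧ z ∉ openCluster (ends '' (↑(E₀ \ s) : Set ι)) x),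
      f (openCluster (ends '' (↑s : Set ι)) x) * (g (openCluster (ends '' (↑s : Set ι)) x) - g (openCluster (ends '' (↑(E₀ \ s) : Set ι)) x)) := by
  refine cwpa_coreClass_of_leaf_pocketFree_leaf ends EH E₀ x z a a' b b' e₁ e₂ ixa ixb iza izb he₁ he₂ hends₁ hends₂ ha'E hb'E ha'a ha'b hb'b hb'a'
    hxa hxb hza hzb hH hE₀ hnot hd hxz hxa' hxb' hza' hzb' ?_ f g hf hg
  intro ω hω hbR hbB
  exact pocketFree_of_deg_le_two ends EH a b hdeg ω hω hbR (fun hx => hbB ((mem_openCluster_comm ends (EH \ ω) a b).mpr hx))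

end Coefficientwise

end Summit.CriticalPhenomena.PercolationContinuityZ3.Theorems
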